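import Summits.AnomalousDissipation.AnomalousDissipation.Theorems.MomentParityResolvedDissipationTrajectoryUIOfGalerkinEE
import Summits.AnomalousDissipation.AnomalousDissipation.Theorems.MomentParityResolvedDissipationSuperLerayWindow
import Summits.AnomalousDissipation.AnomalousDissipation.Theorems.MomentParityResolvedDissipationOrlicz
import Summits.AnomalousDissipation.AnomalousDissipation.Theorems.MomentParityResolvedDissipationReduction
import Summits.AnomalousDissipation.AnomalousDissipation.Theorems.MomentParityResolvedDissipationConverse
import Summits.AnomalousDissipation.AnomalousDissipation.Theorems.MomentParityUniformResolutionOfResolvedDissipation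
import Summits.AnomalousDissipation.AnomalousDissipation.Theorems.ResolvedDissipation.Negative.KillShape

/-!
# STRATEGY-CENSUS (gen 1, third crux-strategist) — typed companion for crux `MomentParity.ResolvedDissipation`
# (stmt-AnomalousDissipation-14284)

Nothing here is new mathematics and nothing is proposed to `Theorems/` (strategist remit). This file only
CERTIFIES BY NAME, against the tree of 2026-08-17 ~08:00Z, the claims of `STRATEGY-CENSUS.md` §Decomposition /
§Strengthen: every sufficient condition produced by the crux chain so far is a ONE-PIECE re-rooting
`Leaf → ResolvedDissipation` whose glue is already a tree theorem, so no `route edit --split` (2 ≤ k) with two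
genuine open pieces exists among them; and the weakest NAMED Orlicz strengthening (`L log L`) is typed.

Leaves (named Props, verbatim hypothesis types of the landed bridge theorems):
* `GEE`  — energy equality between positive times for Fourier–Galerkin limits (lead c6, p145184);
* `TUI`  — trajectory uniform integrability of the Galerkin enstrophy (= registered `stub_trajectoryUI`, c4);
* `SLW`  — super-Leray local window (c5, p141981);
* `GEB`  — `N`-uniform Galerkin enstrophy ceiling (gen-0 strategist S⁺1; c4 p140175);
* `LlogL` — `N`-uniform `E_μ[Z log(2+Z)]` bound over admissible laws (the weakest named Orlicz strengthening;
  tree docstring of `…Orlicz.uniformlyIntegrableEnstrophy_of_superlinear`).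
Bridges by name: `rd_of_GEE`, `rd_of_TUI`, `rd_of_SLW`, `rd_of_GEB`, `ur_of_rd` (RD → UniformResolution).
-/

noncomputable section

set_option linter.dupNamespace false

namespace Summit.AnomalousDissipation.AnomalousDissipation.Cruxes.ResolvedDissipation.StrategyCensusG1

open MeasureTheory Filter Topology Set
open scoped ENNReal InnerProductSpace RealInnerProductSpace
open Literature.Analysis.FunctionSpaces Literature.Analysis.FluidPDE
open Summit.AnomalousDissipation.AnomalousDissipation.Theses.MomentParity
open Summit.AnomalousDissipation.AnomalousDissipation.Theorems.MomentParityResolvedDissipation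
open Summit.AnomalousDissipation.AnomalousDissipation.Theorems.MomentParity
open Summit.AnomalousDissipation.AnomalousDissipation.Theorems.QuarticGate.Negative
  (IsLevel IsPolyStationary)

/-- **GEE** — energy equality between positive times for coefficientwise limits of Hopf–Galerkin families of
NS(ν, f) with strongly `L²`-convergent data (verbatim hypothesis of
`TrajectoryUIOfGalerkinEE.resolvedDissipation_of_galerkinLimitEnergyEquality`). Conjecture-grade (open, `d = 3`). -/
def GEE : Prop :=
  ∀ (ν : ℝ), 0 < ν → ∀ (f : UnitAddTorus (Fin 3) → EuclideanSpace ℝ (Fin 3)),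
      Torus.IsSmooth f → Torus.IsDivFree f → Torus.HasZeroMean f →
      ∀ (u₀ : UnitAddTorus (Fin 3) → EuclideanSpace ℝ (Fin 3)), MemLp u₀ 2 volume →
      ∀ (N : ℕ → ℕ) (U : ℕ → ℝ → UnitAddTorus (Fin 3) → EuclideanSpace ℝ (Fin 3))
        (u : ℝ → UnitAddTorus (Fin 3) → EuclideanSpace ℝ (Fin 3)),
      IsHopfGalerkinFamily ν (fun _ => f) u₀ N (fun _ _ => f) U →
      AEStronglyMeasurable (Torus.stLift u) (volume.restrict (Set.Ioi (0 : ℝ) ×ˢ Set.univ)) →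
      (∀ t, 0 ≤ t → MemLp (u t) 2 volume) →
      (∀ t, 0 ≤ t → ∀ k, Filter.Tendsto
        (fun n => UnitAddTorus.mFourierCoeff (EuclideanSpace.complexify ∘ U n t) k) Filter.atTop
        (𝓝 (UnitAddTorus.mFourierCoeff (EuclideanSpace.complexify ∘ u t) k))) →
      Filter.Tendsto (fun n => eLpNorm (U n 0 - u 0) 2 volume) Filter.atTop (𝓝 0) →
      ∀ (t₀ t₁ : ℝ), 0 < t₀ → t₀ ≤ t₁ →
        Torus.kineticEnergy (u t₁) + ν * (∫⁻ τ in Set.Ioo t₀ t₁, Torus.eGradNormSq (u τ)).toReal =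
          Torus.kineticEnergy (u t₀) + ∫ τ in t₀..t₁, ∫ x, ⟪f x, u τ x⟫_ℝ

/-- **TUI** — the registered hard stub `stub_trajectoryUI` of line `enstrophy-ui-transfer`, verbatim. -/
def TUI : Prop :=
  ∀ f : UnitAddTorus (Fin 3) → EuclideanSpace ℝ (Fin 3),
      Torus.IsSmooth f → Torus.IsDivFree f → Torus.HasZeroMean f →
      ∀ ν : ℝ, 0 < ν → ∀ R : ℝ, ∃ T : ℝ, 0 < T ∧
        ∀ G : ℝ≥0∞, G ≠ ⊤ → ∀ ε : ℝ≥0∞, 0 < ε → ∃ M : ℝ≥0∞, M ≠ ⊤ ∧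
          ∀ (N : ℕ) (a : UnitAddTorus (Fin 3) → EuclideanSpace ℝ (Fin 3)),
            IsGalerkinMode N a → Torus.HasZeroMean a → ∫ x, ‖a x‖ ^ 2 ≤ R ^ 2 →
            Torus.eGradNormSq a ≤ G →
            ∫⁻ t in Set.Ioo 0 T, (Set.Ioi M).indicator id
                (Torus.eGradNormSq (Torus.galerkinFlow ν f N t a)) ≤ ε

/-- **SLW** — super-Leray local window (hypothesis of `SuperLerayWindow.resolvedDissipation_of_superLerayWindow`). -/
def SLW : Prop :=
  ∀ f : UnitAddTorus (Fin 3) → EuclideanSpace ℝ (Fin 3),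
      Torus.IsSmooth f → Torus.IsDivFree f → Torus.HasZeroMean f → ∀ ν : ℝ, 0 < ν → ∀ R : ℝ,
      ∀ C : ℝ, ∃ g : ℝ, C ≤ g ∧ 0 < g ∧ ∃ T : ℝ, 0 < T ∧ C ≤ g * T ∧ ∃ M : ℝ≥0∞, M ≠ ⊤ ∧
        ∀ (N : ℕ) (a : UnitAddTorus (Fin 3) → EuclideanSpace ℝ (Fin 3)),
          IsGalerkinMode N a → Torus.HasZeroMean a → ∫ x, ‖a x‖ ^ 2 ≤ R ^ 2 →
          Torus.eGradNormSq a ≤ ENNReal.ofReal g →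
          ∀ t ∈ Set.Ioo 0 T, Torus.eGradNormSq (Torus.galerkinFlow ν f N t a) ≤ M

/-- **GEB** — `N`-uniform enstrophy ceiling (hypothesis of `TrajectoryUI.resolvedDissipation_of_enstrophyCeiling`). -/
def GEB : Prop :=
  ∀ f : UnitAddTorus (Fin 3) → EuclideanSpace ℝ (Fin 3),
      Torus.IsSmooth f → Torus.IsDivFree f → Torus.HasZeroMean f →
      ∀ ν : ℝ, 0 < ν → ∀ R : ℝ, ∃ T : ℝ, 0 < T ∧
        ∀ G : ℝ≥0∞, G ≠ ⊤ → ∃ M : ℝ≥0∞, M ≠ ⊤ ∧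
          ∀ (N : ℕ) (a : UnitAddTorus (Fin 3) → EuclideanSpace ℝ (Fin 3)),
          IsGalerkinMode N a → Torus.HasZeroMean a → ∫ x, ‖a x‖ ^ 2 ≤ R ^ 2 → Torus.eGradNormSq a ≤ G →
          ∀ t ∈ Set.Ioo 0 T, Torus.eGradNormSq (Torus.galerkinFlow ν f N t a) ≤ M

/-- **LlogL** — the weakest NAMED Orlicz strengthening of the crux: an `N`-uniform bound on
`E_μ[Z log(2+Z)]`, `Z = ‖∇u‖²`, over all admissible (level-`N`, bounded-support, all-order polynomially stationary)
laws. By `…Orlicz.uniformlyIntegrableEnstrophy_of_superlinear` + `…Reduction.resolvedDissipation_of_uniformIntegrability`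
it implies the crux at each `(f, ν, R)`; by de la Vallée-Poussin the crux is EQUIVALENT to `∃ Φ` superlinear with such
a bound (no named `Φ`). Not known even for time averages of ONE Leray–Hopf solution (`∫₀ᵀ Z log(2+Z) dt < ∞` is an
ε-supercritical a-priori bound; the known ones — `∫ Z`, `∫ |Au|^{2/3}` (FGT 1981), `∇²u ∈ L^{4/3,∞}` (Choi–Vasseur
doi:10.1016/j.anihpc.2013.08.001) — are all scaling-critical). [conjecture-grade; typed only] -/
def LlogL : Prop :=
  ∀ f : UnitAddTorus (Fin 3) → EuclideanSpace ℝ (Fin 3),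
      Torus.IsSmooth f → Torus.IsDivFree f → Torus.HasZeroMean f →
      ∀ ν : ℝ, 0 < ν → ∀ R : ℝ, ∃ B : ℝ≥0∞, B ≠ ⊤ ∧
        ∀ (N : ℕ) (μ : Measure (Torus.energySpace (Fin 3))), IsProbabilityMeasure μ →
          (∀ᵐ u ∂μ, IsLevel N u) → (∀ᵐ u ∂μ, ‖u‖ ≤ R) → (∀ d : ℕ, IsPolyStationary ν f N d μ) →
          ∫⁻ u, Torus.eGradNormSq (u.1 : UnitAddTorus (Fin 3) → EuclideanSpace ℝ (Fin 3)) *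
              ENNReal.ofReal (Real.log (2 +
                (Torus.eGradNormSq (u.1 : UnitAddTorus (Fin 3) → EuclideanSpace ℝ (Fin 3))).toReal)) ∂μ ≤ B

/-! ## The one-piece re-rootings, certified by name (each glue is a landed tree theorem) -/

theorem rd_of_GEE : GEE → ResolvedDissipation :=
  fun h => TrajectoryUIOfGalerkinEE.resolvedDissipation_of_galerkinLimitEnergyEquality h

theorem rd_of_TUI : TUI → ResolvedDissipation :=
  fun h => TrajectoryUI.resolvedDissipation_of_trajectoryUI h

theorem rd_of_SLW : SLW → ResolvedDissipation :=
  fun h => SuperLerayWindow.resolvedDissipation_of_superLerayWindow h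

theorem rd_of_GEB : GEB → ResolvedDissipation :=
  fun h => TrajectoryUI.resolvedDissipation_of_enstrophyCeiling h

theorem ur_of_rd : ResolvedDissipation → UniformResolution :=
  Summit.AnomalousDissipation.AnomalousDissipation.Theorems.MomentParityUniformResolution.uniformResolution_of_resolvedDissipation

/-- The ladder of leaves, by name: GEE ⟹ TUI (c6). -/
theorem tui_of_GEE : GEE → TUI :=
  fun h => TrajectoryUIOfGalerkinEE.trajectoryUI_of_galerkinLimitEnergyEquality h

end Summit.AnomalousDissipation.AnomalousDissipation.Cruxes.ResolvedDissipation.StrategyCensusG1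

end
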